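import Literature.NumberTheory.Automorphic.RankinSelbergQuotientUnfolding
import Literature.MeasureTheory.Group.CoveringWeightsBochner
import Mathlib.MeasureTheory.Integral.Prod
import HarnessLib

/-!
# The group side of the twisted Rankin–Selberg unfolding: the `𝕀_K¹`-average against a character
# becomes a central-character integral (Bochner form of `lintegral_testFun_mul_eq`)

Topic `NumberTheory/Automorphic`; namespace `Literature.NumberTheory.Automorphic`. Proof file
(theorems only). A brick of the inline decomposition of the named fact
`MoeglinWaldspurger1989_partialPairL_entire_of_ne_conj` (Mœglin–Waldspurger (1989), Appendice,
Cor. (i)(b)) for the pairs `(π, σ)` of cuspidal representations of `GL_n(𝔸_K)` whose central characters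
do not cancel, where Cogdell's proof (*Analytic theory of `L`-functions for `GL_n`*, §2.3, p. 211)
integrates `φ φ'` against the mirabolic Eisenstein series **twisted by `η = ω_π ω_{π'}`**
(`MirabolicEisensteinSeriesTwisted`, `RankinSelbergIntegralTwistedEntire`). The first unfolding of that
integral from the automorphic quotient `X = GL_n(𝔸_K) ⧸ A_G GL_n(K)` to the group runs exactly as the
untwisted one (`RankinSelbergQuotientUnfolding.exists_lintegral_eisensteinLIntegral_mul_eq`, Jacquet–Shalika
(1981), §4; Cogdell, §2.3), but with complex (oscillating) integrands, and with one change of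
mechanism: on the group side the `𝕀_K¹`-average no longer disappears by central *invariance* of
`F = φ φ'` but produces the integral of the twisting character against the central *character* of `F`.
This file proves that step — the Bochner form of `lintegral_testFun_mul_eq`:

* `integral_testFunTwisted_mul_eq` (**main**). Let `ν` be a Haar measure on the unimodular `GL_n(𝔸_K)`,
  `sc : 𝔸_Kˣ → GL_n(𝔸_K)` central and continuous (the scalars), `W : GL_n(𝔸_K) → ℂ` Borel and
  `GL_n(K)`-invariant, `βA` a `GL_n(K)`-covering weight, `β¹ ≥ 0` Borel on `𝕀_K¹` with `∫ β¹ dβ < ∞`,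
  `η : 𝕀_K¹ → ℂ` Borel with `|η| ≤ 1`, and `F : X → ℂ` Borel with a **unitary central character along
  `sc`**: `F(π(sc z · y)) = ξ(z) F(π y)`, `|ξ| = 1`. If `∫ |W(g) F(π g⁻¹)| βA(g) dν < ∞`, then

    `∫ f(g) F(π g) dν(g) = (∫_{𝕀¹} η(b) ξ(b) β¹(b) dβ) · ∫ W(g) βA(g) F(π g⁻¹) dν(g)`,
    `f(y) = (∫_{𝕀¹} W(sc(b) y⁻¹) η(b) β¹(b) dβ) βA(y⁻¹)`

  (inversion `g ↦ g⁻¹`, Fubini — the absolute convergence being the untwisted `[0, ∞]` identity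
  `lintegral_testFun_mul_eq` for `|W|`, `|F|` —, the translation `g ↦ sc(b)⁻¹ g`, the central character
  of `F`, and the independence of the covering weight for Bochner integrals,
  `integral_wt_smul_eq_of_coveringSum_eq_one`). For `η = ξ⁻¹` on `𝕀_K¹` the factor is `∫ β¹ dβ`, as in
  the untwisted case; for `η ξ` a non-trivial character of `𝕀_K¹ / Kˣ` and `β¹` a `Kˣ`-covering weight it
  vanishes (orthogonality) — the design fact that the trivial-character Eisenstein series only sees the
  pairs with `ω_π ω̄_σ = 1`.
* `lintegral_testFunTwisted_norm_lt_top` — the absolute convergence used for Fubini.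

## References

* H. Jacquet, J. A. Shalika, *On Euler products and the classification of automorphic
  representations I*, Amer. J. Math. 103 (1981), §4 [JacquetShalikaAJM1981].
* J. W. Cogdell, *Analytic theory of L-functions for GL_n*, in *An Introduction to the Langlands
  Program* (2004), §2.3, pp. 209–211 [CogdellAnalyticTheory2004].
-/

noncomputable section

open MeasureTheory Measure Set Filter Topology IsDedekindDomain NumberField Function
open Literature.MeasureTheory.Group
open scoped ENNReal NNReal Pointwise

namespace Literature.NumberTheory.Automorphic

open Literature.NumberTheory.GaloisRepresentations (ideleGroup principalIdeles)

-- the quotient carries the tree's Borel σ-algebra, not Mathlib's quotient σ-algebra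
attribute [-instance] Quotient.instMeasurableSpace QuotientGroup.measurableSpace

section GroupSide

variable {n : ℕ} {K : Type} [Field K] [NumberField K]

attribute [local instance] adelicBorel borelSpace_adelic locallyCompactSpace_adelic
  secondCountableTopology_gl_adelic glAdeleBorel borelSpace_glAdele

variable [MeasurableSpace (ideleGroup K)] [BorelSpace (ideleGroup K)]

/-- `‖((β x).toReal : ℂ)‖ₑ ≤ β x`. [folklore] -/
theorem enorm_ofReal_wt_le {X : Type*} (β : X → ℝ≥0∞) (x : X) : ‖((wt β x : ℝ) : ℂ)‖ₑ ≤ β x := by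
  rw [← ofReal_norm, Complex.norm_real, Real.norm_of_nonneg ENNReal.toReal_nonneg]
  exact ENNReal.ofReal_toReal_le

/-- **Absolute convergence of the twisted group-side integrand.** With the data of
`integral_testFunTwisted_mul_eq`, the function `(b, g) ↦ W(sc(b) g) η(b) β¹(b) βA(g) F(π g⁻¹)` has finite
`[0, ∞]`-integral over `𝕀_K¹ × GL_n(𝔸_K)`: bounded by the untwisted identity `lintegral_testFun_mul_eq` for
`|W|`, `|F|` (which is invariant under the centre, `|ξ| = 1`), i.e. by
`(∫ β¹ dβ) ∫ |W| βA |F(π ·⁻¹)| dν < ∞`. [folklore] -/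
theorem lintegral_testFunTwisted_norm_lt_top
    (ν : Measure (AdelicGroupData.gl n K).Adelic) [ν.IsHaarMeasure] [ν.IsInvInvariant]
    (β : Measure ↥(normOneIdeles K)) [SFinite β]
    (sc : ideleGroup K →* (AdelicGroupData.gl n K).Adelic) (hsc_cont : Continuous sc)
    (hsc_comm : ∀ (a : ideleGroup K) (g : (AdelicGroupData.gl n K).Adelic), sc a * g = g * sc a)
    {β₁ : ↥(normOneIdeles K) → ℝ≥0∞} (hβ₁ : Measurable β₁) (hβ₁fin : ∫⁻ b, β₁ b ∂β < ⊤)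
    {η : ↥(normOneIdeles K) → ℂ} (hη1 : ∀ b, ‖η b‖ ≤ 1)
    {W : (AdelicGroupData.gl n K).Adelic → ℂ} (hW : Measurable W)
    (hWK : ∀ (γ : GL (Fin n) K) (y : (AdelicGroupData.gl n K).Adelic), W ((AdelicGroupData.gl n K).toAdelic γ * y) = W y)
    {βA : (AdelicGroupData.gl n K).Adelic → ℝ≥0∞} (hβA : Measurable βA)
    (hβAsum : ∀ y, coveringSum ↥(AdelicGroupData.gl n K).arithmeticSubgroup βA y = 1)
    {F : (AdelicGroupData.gl n K).automorphicQuotient → ℂ} (hF : Measurable F)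
    {ξ : Literature.NumberTheory.GaloisRepresentations.HeckeCharacter K} (hξ1 : ξ.IsUnitary)
    (hFZ : ∀ (z : ideleGroup K) (y : (AdelicGroupData.gl n K).Adelic),
      F ((AdelicGroupData.gl n K).toAutomorphicQuotient (sc z * y)) =
        ((ξ z : ℂˣ) : ℂ) * F ((AdelicGroupData.gl n K).toAutomorphicQuotient y))
    (hint : ∫⁻ g, ‖W g * F ((AdelicGroupData.gl n K).toAutomorphicQuotient g⁻¹)‖ₑ * βA g ∂ν < ⊤) :
    ∫⁻ q : ↥(normOneIdeles K) × (AdelicGroupData.gl n K).Adelic,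
        ‖W (sc (q.1 : ideleGroup K) * q.2) * η q.1 * (wt β₁ q.1 : ℂ) *
          ((wt βA q.2 : ℂ) * F ((AdelicGroupData.gl n K).toAutomorphicQuotient q.2⁻¹))‖ₑ ∂(β.prod ν) < ⊤ := by
  classical
  haveI := secondCountableTopology_ideleGroup K
  -- the untwisted identity for `|W|`, `|F|`
  set Wn : (AdelicGroupData.gl n K).Adelic → ℝ≥0∞ := fun y => ‖W y‖ₑ with hWn
  set Fn : (AdelicGroupData.gl n K).automorphicQuotient → ℝ≥0∞ := fun x => ‖F x‖ₑ with hFn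
  have hWn_meas : Measurable Wn := hW.enorm
  have hFn_meas : Measurable Fn := hF.enorm
  have hWnK : ∀ (γ : GL (Fin n) K) (y : (AdelicGroupData.gl n K).Adelic),
      Wn ((AdelicGroupData.gl n K).toAdelic γ * y) = Wn y := fun γ y => by simp only [hWn, hWK]
  have hFnZ : ∀ (z : ideleGroup K) (y : (AdelicGroupData.gl n K).Adelic),
      Fn ((AdelicGroupData.gl n K).toAutomorphicQuotient (sc z * y)) = Fn ((AdelicGroupData.gl n K).toAutomorphicQuotient y) := by
    intro z y
    simp only [hFn, hFZ, enorm_mul]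
    have h : ‖((ξ z : ℂˣ) : ℂ)‖ₑ = 1 := by
      rw [enorm_eq_nnnorm, ENNReal.coe_eq_one, ← NNReal.coe_eq_one, coe_nnnorm, hξ1 z]
    rw [h, one_mul]
  have huntw := lintegral_testFun_mul_eq ν β sc hsc_cont hsc_comm hβ₁ hWn_meas hWnK hβA hβAsum hFn_meas hFnZ
  -- finiteness of its right-hand side
  have hrhs : (∫⁻ b, β₁ b ∂β) * ∫⁻ g, Wn g * βA g * Fn ((AdelicGroupData.gl n K).toAutomorphicQuotient g⁻¹) ∂ν < ⊤ := by
    refine ENNReal.mul_lt_top hβ₁fin ?_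
    refine lt_of_le_of_lt (le_of_eq (lintegral_congr fun g => ?_)) hint
    simp only [hWn, hFn, enorm_mul]
    ring
  -- the left-hand side of the untwisted identity, after `g ↦ g⁻¹`, dominates our integrand
  have hWb_meas : Measurable fun q : ↥(normOneIdeles K) × (AdelicGroupData.gl n K).Adelic =>
      Wn (sc (q.1 : ideleGroup K) * q.2) * β₁ q.1 := by
    refine Measurable.mul (hWn_meas.comp ?_) (hβ₁.comp measurable_fst)
    exact ((hsc_cont.comp (continuous_subtype_val.comp continuous_fst)).mul continuous_snd).measurable
  have hFq : Measurable fun g : (AdelicGroupData.gl n K).Adelic => Fn ((AdelicGroupData.gl n K).toAutomorphicQuotient g⁻¹) :=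
    hFn_meas.comp ((AdelicGroupData.gl n K).continuous_toAutomorphicQuotient.measurable.comp continuous_inv.measurable)
  have hdom : ∀ q : ↥(normOneIdeles K) × (AdelicGroupData.gl n K).Adelic,
      ‖W (sc (q.1 : ideleGroup K) * q.2) * η q.1 * (wt β₁ q.1 : ℂ) *
          ((wt βA q.2 : ℂ) * F ((AdelicGroupData.gl n K).toAutomorphicQuotient q.2⁻¹))‖ₑ ≤
        Wn (sc (q.1 : ideleGroup K) * q.2) * β₁ q.1 *
          (βA q.2 * Fn ((AdelicGroupData.gl n K).toAutomorphicQuotient q.2⁻¹)) := by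
    intro q
    simp only [enorm_mul, hWn, hFn]
    have hη : ‖η q.1‖ₑ ≤ 1 := by
      rw [enorm_eq_nnnorm, ← ENNReal.coe_one, ENNReal.coe_le_coe, ← NNReal.coe_le_coe, coe_nnnorm]
      exact hη1 q.1
    have h1 : ‖(wt β₁ q.1 : ℂ)‖ₑ ≤ β₁ q.1 := enorm_ofReal_wt_le β₁ q.1
    have h2 : ‖(wt βA q.2 : ℂ)‖ₑ ≤ βA q.2 := enorm_ofReal_wt_le βA q.2
    calc ‖W (sc (q.1 : ideleGroup K) * q.2)‖ₑ * ‖η q.1‖ₑ * ‖(wt β₁ q.1 : ℂ)‖ₑ *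
          (‖(wt βA q.2 : ℂ)‖ₑ * ‖F ((AdelicGroupData.gl n K).toAutomorphicQuotient q.2⁻¹)‖ₑ)
        ≤ ‖W (sc (q.1 : ideleGroup K) * q.2)‖ₑ * 1 * β₁ q.1 *
          (βA q.2 * ‖F ((AdelicGroupData.gl n K).toAutomorphicQuotient q.2⁻¹)‖ₑ) := by
          gcongr
      _ = _ := by rw [mul_one]
  calc ∫⁻ q, ‖W (sc (q.1 : ideleGroup K) * q.2) * η q.1 * (wt β₁ q.1 : ℂ) *
          ((wt βA q.2 : ℂ) * F ((AdelicGroupData.gl n K).toAutomorphicQuotient q.2⁻¹))‖ₑ ∂(β.prod ν)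
      ≤ ∫⁻ q, Wn (sc (q.1 : ideleGroup K) * q.2) * β₁ q.1 *
          (βA q.2 * Fn ((AdelicGroupData.gl n K).toAutomorphicQuotient q.2⁻¹)) ∂(β.prod ν) :=
        lintegral_mono hdom
    _ = ∫⁻ b, ∫⁻ g, Wn (sc (b : ideleGroup K) * g) * β₁ b *
          (βA g * Fn ((AdelicGroupData.gl n K).toAutomorphicQuotient g⁻¹)) ∂ν ∂β :=
        lintegral_prod _ (hWb_meas.mul ((hβA.mul hFq).comp measurable_snd)).aemeasurable
    _ = ∫⁻ g, ∫⁻ b, Wn (sc (b : ideleGroup K) * g) * β₁ b *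
          (βA g * Fn ((AdelicGroupData.gl n K).toAutomorphicQuotient g⁻¹)) ∂β ∂ν :=
        lintegral_lintegral_swap (hWb_meas.mul ((hβA.mul hFq).comp measurable_snd)).aemeasurable
    _ = ∫⁻ g, (∫⁻ b, Wn (sc (b : ideleGroup K) * g) * β₁ b ∂β) * βA g *
          Fn ((AdelicGroupData.gl n K).toAutomorphicQuotient g⁻¹) ∂ν := by
        refine lintegral_congr fun g => ?_
        have hmb : Measurable fun b : ↥(normOneIdeles K) => Wn (sc (b : ideleGroup K) * g) * β₁ b :=
          hWb_meas.comp (f := fun b : ↥(normOneIdeles K) => (b, g)) (measurable_id.prodMk measurable_const)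
        rw [lintegral_mul_const _ hmb, mul_assoc]
    _ = ∫⁻ g, (∫⁻ b, Wn (sc (b : ideleGroup K) * g⁻¹) * β₁ b ∂β) * βA g⁻¹ *
          Fn ((AdelicGroupData.gl n K).toAutomorphicQuotient g) ∂ν := by
        rw [← lintegral_inv_eq_self (μ := ν)
          (fun g : (AdelicGroupData.gl n K).Adelic => (∫⁻ b, Wn (sc (b : ideleGroup K) * g⁻¹) * β₁ b ∂β) * βA g⁻¹ *
            Fn ((AdelicGroupData.gl n K).toAutomorphicQuotient g))]
        refine lintegral_congr fun g => ?_
        simp only [inv_inv]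
    _ = (∫⁻ b, β₁ b ∂β) * ∫⁻ g, Wn g * βA g * Fn ((AdelicGroupData.gl n K).toAutomorphicQuotient g⁻¹) ∂ν := huntw
    _ < ⊤ := hrhs

/-- **The group side of the twisted unfolding: the `𝕀_K¹`-average against `η` becomes the integral of
`η` against the central character.** For a Haar measure `ν` on the unimodular `GL_n(𝔸_K)`, a central
continuous `sc : 𝔸_Kˣ → GL_n(𝔸_K)`, a Borel `W : GL_n(𝔸_K) → ℂ` invariant under `GL_n(K)`, a Borel `F` on
the quotient with a unitary central character `ξ` along `sc` (`F(π(sc z · y)) = ξ(z) F(π y)`, `|ξ| = 1`), a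
`GL_n(K)`-covering weight `βA`, a Borel `β¹ ≥ 0` on `𝕀_K¹` of finite integral, a Borel `η : 𝕀_K¹ → ℂ` with
`|η| ≤ 1`, and `∫ |W(g) F(π g⁻¹)| βA(g) dν < ∞`:

  `∫ f(g) F(π g) dν = (∫_{𝕀¹} η(b) ξ(b) β¹(b) dβ) ∫ W(g) βA(g) F(π g⁻¹) dν(g)`,
  `f(y) = (∫_{𝕀¹} W(sc(b) y⁻¹) η(b) β¹(b) dβ) βA(y⁻¹)`

(inversion `g ↦ g⁻¹`, Fubini, the translation `g ↦ sc(b)⁻¹ g`, the central character of `F`, and the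
independence of the covering weight for Bochner integrals, `integral_wt_smul_eq_of_coveringSum_eq_one`) —
the Bochner form of `lintegral_testFun_mul_eq`, Step 3 of the first unfolding of
`∫_{Z GL_n(k)\GL_n(𝔸)} φ φ' E(g, Φ; s, η) dg` (Jacquet–Shalika (1981), §4; Cogdell (2004), §2.3).
[cite: JacquetShalikaAJM1981, §4] [cite: CogdellAnalyticTheory2004, §2.3, p. 211] -/
theorem integral_testFunTwisted_mul_eq
    (ν : Measure (AdelicGroupData.gl n K).Adelic) [ν.IsHaarMeasure] [ν.IsInvInvariant]
    (β : Measure ↥(normOneIdeles K)) [SFinite β]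
    (sc : ideleGroup K →* (AdelicGroupData.gl n K).Adelic) (hsc_cont : Continuous sc)
    (hsc_comm : ∀ (a : ideleGroup K) (g : (AdelicGroupData.gl n K).Adelic), sc a * g = g * sc a)
    {β₁ : ↥(normOneIdeles K) → ℝ≥0∞} (hβ₁ : Measurable β₁) (hβ₁fin : ∫⁻ b, β₁ b ∂β < ⊤)
    {η : ↥(normOneIdeles K) → ℂ} (hηm : Measurable η) (hη1 : ∀ b, ‖η b‖ ≤ 1)
    {W : (AdelicGroupData.gl n K).Adelic → ℂ} (hW : Measurable W)
    (hWK : ∀ (γ : GL (Fin n) K) (y : (AdelicGroupData.gl n K).Adelic), W ((AdelicGroupData.gl n K).toAdelic γ * y) = W y)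
    {βA : (AdelicGroupData.gl n K).Adelic → ℝ≥0∞} (hβA : Measurable βA)
    (hβAsum : ∀ y, coveringSum ↥(AdelicGroupData.gl n K).arithmeticSubgroup βA y = 1)
    {F : (AdelicGroupData.gl n K).automorphicQuotient → ℂ} (hF : Measurable F)
    {ξ : Literature.NumberTheory.GaloisRepresentations.HeckeCharacter K} (hξ1 : ξ.IsUnitary)
    (hFZ : ∀ (z : ideleGroup K) (y : (AdelicGroupData.gl n K).Adelic),
      F ((AdelicGroupData.gl n K).toAutomorphicQuotient (sc z * y)) =
        ((ξ z : ℂˣ) : ℂ) * F ((AdelicGroupData.gl n K).toAutomorphicQuotient y))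
    (hint : ∫⁻ g, ‖W g * F ((AdelicGroupData.gl n K).toAutomorphicQuotient g⁻¹)‖ₑ * βA g ∂ν < ⊤) :
    ∫ g, (∫ b, W (sc (b : ideleGroup K) * g⁻¹) * η b * (wt β₁ b : ℂ) ∂β) * (wt βA g⁻¹ : ℂ) *
        F ((AdelicGroupData.gl n K).toAutomorphicQuotient g) ∂ν =
      (∫ b, η b * ((ξ (b : ideleGroup K) : ℂˣ) : ℂ) * (wt β₁ b : ℂ) ∂β) *
        ∫ g, W g * (wt βA g : ℂ) * F ((AdelicGroupData.gl n K).toAutomorphicQuotient g⁻¹) ∂ν := by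
  classical
  haveI := secondCountableTopology_ideleGroup K
  have hπ : ∀ g : (AdelicGroupData.gl n K).Adelic, (AdelicGroupData.gl n K).toAutomorphicQuotient g =
      (QuotientGroup.mk g : (AdelicGroupData.gl n K).automorphicQuotient) := fun g => rfl
  -- the joint integrand and its integrability
  set Kf : ↥(normOneIdeles K) × (AdelicGroupData.gl n K).Adelic → ℂ := fun q =>
    W (sc (q.1 : ideleGroup K) * q.2) * η q.1 * (wt β₁ q.1 : ℂ) *
      ((wt βA q.2 : ℂ) * F ((AdelicGroupData.gl n K).toAutomorphicQuotient q.2⁻¹)) with hKf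
  have hFq : Measurable fun g : (AdelicGroupData.gl n K).Adelic => F ((AdelicGroupData.gl n K).toAutomorphicQuotient g⁻¹) :=
    hF.comp ((AdelicGroupData.gl n K).continuous_toAutomorphicQuotient.measurable.comp continuous_inv.measurable)
  have hwt₁ : Measurable fun b : ↥(normOneIdeles K) => (wt β₁ b : ℂ) :=
    Complex.measurable_ofReal.comp hβ₁.ennreal_toReal
  have hwtA : Measurable fun g : (AdelicGroupData.gl n K).Adelic => (wt βA g : ℂ) :=
    Complex.measurable_ofReal.comp hβA.ennreal_toReal
  have hKf_meas : Measurable Kf := by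
    refine Measurable.mul (Measurable.mul (Measurable.mul (hW.comp ?_) (hηm.comp measurable_fst))
      (hwt₁.comp measurable_fst)) ((hwtA.mul hFq).comp measurable_snd)
    exact ((hsc_cont.comp (continuous_subtype_val.comp continuous_fst)).mul continuous_snd).measurable
  have hKf_int : Integrable Kf (β.prod ν) :=
    ⟨hKf_meas.aestronglyMeasurable, lintegral_testFunTwisted_norm_lt_top ν β sc hsc_cont hsc_comm hβ₁ hβ₁fin
      hη1 hW hWK hβA hβAsum hF hξ1 hFZ hint⟩
  -- Step 1: inversion `g ↦ g⁻¹`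
  have e1 : ∫ g, (∫ b, W (sc (b : ideleGroup K) * g⁻¹) * η b * (wt β₁ b : ℂ) ∂β) * (wt βA g⁻¹ : ℂ) *
        F ((AdelicGroupData.gl n K).toAutomorphicQuotient g) ∂ν =
      ∫ g, (∫ b, W (sc (b : ideleGroup K) * g) * η b * (wt β₁ b : ℂ) ∂β) * (wt βA g : ℂ) *
        F ((AdelicGroupData.gl n K).toAutomorphicQuotient g⁻¹) ∂ν := by
    rw [← integral_inv_eq_self
      (fun g : (AdelicGroupData.gl n K).Adelic => (∫ b, W (sc (b : ideleGroup K) * g⁻¹) * η b * (wt β₁ b : ℂ) ∂β) *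
        (wt βA g⁻¹ : ℂ) * F ((AdelicGroupData.gl n K).toAutomorphicQuotient g)) ν]
    refine integral_congr_ae (ae_of_all _ fun g => ?_)
    simp only [inv_inv]
  rw [e1]
  -- Step 2: Fubini
  have e2 : ∫ g, (∫ b, W (sc (b : ideleGroup K) * g) * η b * (wt β₁ b : ℂ) ∂β) * (wt βA g : ℂ) *
        F ((AdelicGroupData.gl n K).toAutomorphicQuotient g⁻¹) ∂ν =
      ∫ b, ∫ g, Kf (b, g) ∂ν ∂β := by
    have e3 : ∀ g : (AdelicGroupData.gl n K).Adelic,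
        (∫ b, W (sc (b : ideleGroup K) * g) * η b * (wt β₁ b : ℂ) ∂β) * (wt βA g : ℂ) *
          F ((AdelicGroupData.gl n K).toAutomorphicQuotient g⁻¹) = ∫ b, Kf (b, g) ∂β := by
      intro g
      rw [mul_assoc, ← integral_mul_const]
    simp_rw [e3]
    exact integral_integral_swap hKf_int.swap
  rw [e2]
  -- Step 3: for each `b`, translate by `sc(b)⁻¹`, use the central character and change the covering weight
  set I₀ : ℂ := ∫ g, W g * (wt βA g : ℂ) * F ((AdelicGroupData.gl n K).toAutomorphicQuotient g⁻¹) ∂ν with hI₀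
  have e4 : ∀ b : ↥(normOneIdeles K), ∫ g, Kf (b, g) ∂ν =
      η b * ((ξ (b : ideleGroup K) : ℂˣ) : ℂ) * (wt β₁ b : ℂ) * I₀ := by
    intro b
    -- translate `g ↦ sc(b)⁻¹ g`
    have e5 : ∫ g, Kf (b, g) ∂ν =
        ∫ g, W g * η b * (wt β₁ b : ℂ) * ((wt βA ((sc (b : ideleGroup K))⁻¹ * g) : ℂ) *
          (((ξ (b : ideleGroup K) : ℂˣ) : ℂ) * F ((AdelicGroupData.gl n K).toAutomorphicQuotient g⁻¹))) ∂ν := by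
      have h1 : (fun g : (AdelicGroupData.gl n K).Adelic => Kf (b, g)) =
          fun g => (fun x : (AdelicGroupData.gl n K).Adelic => Kf (b, (sc (b : ideleGroup K))⁻¹ * x))
            (sc (b : ideleGroup K) * g) := by
        funext g
        simp only [inv_mul_cancel_left]
      rw [h1, integral_mul_left_eq_self (fun x : (AdelicGroupData.gl n K).Adelic =>
        Kf (b, (sc (b : ideleGroup K))⁻¹ * x)) (sc (b : ideleGroup K))]
      refine integral_congr_ae (ae_of_all _ fun x => ?_)
      simp only [hKf, mul_inv_cancel_left, mul_inv_rev, inv_inv]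
      congr 2
      -- `F(π (x⁻¹ sc(b))) = F(π (sc(b) x⁻¹)) = ξ(b) F(π x⁻¹)`
      have hcomm : x⁻¹ * sc (b : ideleGroup K) = sc (b : ideleGroup K) * x⁻¹ := (hsc_comm _ _).symm
      rw [hcomm, hFZ]
    rw [e5]
    -- pull out the constants and change the covering weight `βA(sc(b)⁻¹ ·)` back to `βA`
    have e6 : ∀ g : (AdelicGroupData.gl n K).Adelic, W g * η b * (wt β₁ b : ℂ) *
        ((wt βA ((sc (b : ideleGroup K))⁻¹ * g) : ℂ) *
          (((ξ (b : ideleGroup K) : ℂˣ) : ℂ) * F ((AdelicGroupData.gl n K).toAutomorphicQuotient g⁻¹))) =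
        (η b * ((ξ (b : ideleGroup K) : ℂˣ) : ℂ) * (wt β₁ b : ℂ)) *
          ((wt (fun g => βA ((sc (b : ideleGroup K))⁻¹ * g)) g : ℝ) •
            (W g * F ((AdelicGroupData.gl n K).toAutomorphicQuotient g⁻¹))) := by
      intro g
      rw [Complex.real_smul]
      simp only [wt]
      ring
    simp_rw [e6]
    rw [integral_const_mul]
    congr 1
    set z : (AdelicGroupData.gl n K).Adelic := sc (b : ideleGroup K) with hz
    -- independence of the covering weight
    set Φ : (AdelicGroupData.gl n K).Adelic → ℂ := fun g => W g * F ((AdelicGroupData.gl n K).toAutomorphicQuotient g⁻¹)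
      with hΦ
    have hΦm : StronglyMeasurable Φ := (hW.mul hFq).stronglyMeasurable
    have hΦinv : ∀ (γ : ↥(AdelicGroupData.gl n K).arithmeticSubgroup) (g : (AdelicGroupData.gl n K).Adelic),
        Φ (γ • g) = Φ g := by
      intro γ g
      obtain ⟨γ₀, hγ₀⟩ := γ.2
      simp only [hΦ]
      rw [Subgroup.smul_def, smul_eq_mul, ← hγ₀, hWK, mul_inv_rev]
      congr 2
      -- `π(g⁻¹ γ₀⁻¹) = π(g⁻¹)`
      rw [hπ, hπ]
      refine QuotientGroup.eq.2 ?_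
      rw [mul_inv_rev, inv_inv, inv_inv, mul_assoc, mul_inv_cancel, mul_one]
      exact (AdelicGroupData.gl n K).arithmeticSubgroup_le_quotientSubgroup ⟨γ₀, rfl⟩
    have hβz : Measurable fun g : (AdelicGroupData.gl n K).Adelic => βA (z⁻¹ * g) :=
      hβA.comp (measurable_const.mul measurable_id)
    have hβGz : ∀ g : (AdelicGroupData.gl n K).Adelic,
        coveringSum ↥(AdelicGroupData.gl n K).arithmeticSubgroup
          (fun g : (AdelicGroupData.gl n K).Adelic => βA (z⁻¹ * g)) g = 1 := by
      intro g
      simp only [coveringSum_apply]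
      have : ∀ γ : ↥(AdelicGroupData.gl n K).arithmeticSubgroup, βA (z⁻¹ * (γ • g)) = βA (γ • (z⁻¹ * g)) := by
        intro γ
        rw [Subgroup.smul_def, Subgroup.smul_def, smul_eq_mul, smul_eq_mul, ← mul_assoc, ← mul_assoc]
        congr 2
        rw [hz, ← map_inv]
        exact hsc_comm _ _
      simp_rw [this]
      have h := hβAsum (z⁻¹ * g)
      rw [coveringSum_apply] at h
      exact h
    have hintΦ : ∫⁻ g, ‖Φ g‖ₑ * βA g ∂ν < ⊤ := hint
    have hind := integral_wt_smul_eq_of_coveringSum_eq_one ν hΦm hΦinv hβA hβz hβAsum hβGz hintΦ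
    rw [← hind, hI₀]
    refine integral_congr_ae (ae_of_all _ fun g => ?_)
    simp only [hΦ, Complex.real_smul, wt]
    ring
  simp_rw [e4]
  exact integral_mul_const I₀ _

end GroupSide

end Literature.NumberTheory.Automorphic
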